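import Mathlib
import HarnessLib
import Literature.Analysis.SpecialFunctions.EulerMascheroniBounds

/-!
# `GapRung 1`, regime `n₀ ≥ 11`: the constant inequality `Φ(n₀) ≥ -19/100`
(crux `SignConeInequality`, stmt-RiemannHypothesis-16301; cell `Cruxes/SignConeInequality/`, rung `GapRung 1`,
registered stubs `stub_gap_mid` / `stub_gap_large` of line `gap-rung-one`)

The landed signed far-field majorant (`SignCone.signedFarFieldMajorant`) with the excursion `(α, α + ℓ]`,
`α = log n₀`, `ℓ = log (n₀+1) − log n₀` (one node gap) and dip depth `D` gives
`Re W_ar(F) ≥ −A + (19/100)·A + D·Φ(n₀)` with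

  `Φ(n₀) = log(12209/89041) − (log(e^ℓ − 1) − log(e^ℓ + 1)) − (97/28)(4 log(15/14) − ℓ)
            − 8 (sinh((α + ℓ)/2) − sinh(α/2))`
        `= log(12209/89041) + log(2n₀+1) − (97/28)(4 log(15/14) − log(1 + 1/n₀))
            − 4 (√(n₀+1) − 1/√(n₀+1) − √n₀ + 1/√n₀)`.

Since `0 ≤ D ≤ A`, the unit-slack inequality follows as soon as `Φ(n₀) ≥ −19/100`.  Numerically
`Φ(10) = −0.2445 < −0.19 < Φ(11) = −0.1473 < Φ(12) = −0.0579 < 0 < Φ(13)`, and `Φ` increases beyond; this file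
certifies `Φ(n₀) ≥ −19/100` for every `n₀ ≥ 11` (`gapPhi_ge`) from: `log(12209/89041) ≥ −1.9871`
(`e² > 7.38905`, `log y ≤ y − 1`), `log(15/14) ≤ 29/420` (trapezoid), `log(1 + 1/n) ≥ 2/(2n+1)`,
`√(n+1) − √n ≤ 1/(2√n)`, `1/√n − 1/√(n+1) ≤ 1/(2n√n)`, and the cases `n₀ = 11` (`log 23 ≥ log 24 − ½(1/23 + 1/24)`,
`√11 ≥ 3.3166`; certified slack `0.025`), `12` (`log 25 ≥ log 24 + 2/49`), `13` (`log 27 = 3 log 3`),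
`n₀ ≥ 14` (`log(2n₀+1) ≥ log 24 + log(6/5)`, `√n₀ ≥ 3.7416`), with `log 24 = 3 log 2 + log 3` from Mathlib's decimals.
-/

noncomputable section

-- `Summit.RiemannHypothesis.RiemannHypothesis.…` repeats a namespace component by design (D-0017 layout).
set_option linter.dupNamespace false

namespace Summit.RiemannHypothesis.RiemannHypothesis.Theorems.SignCone

open Literature.Analysis.SpecialFunctions.Real

/-- `log(12209/89041) ≥ −1.9871` (true value `−1.98692…`): `89041/12209 = e²·q` with `q ≤ 0.9871`
and `log q ≤ q − 1`. [folklore] -/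
theorem log_tanh_t₁_ge : -1.9871 ≤ Real.log (12209 / 89041) := by
  have he : 2.7182818283 < Real.exp 1 := Real.exp_one_gt_d9
  have he2 : 7.38905 < Real.exp 2 := by
    have e : Real.exp 2 = Real.exp 1 * Real.exp 1 := by rw [← Real.exp_add]; norm_num
    rw [e]; nlinarith
  have hpos : 0 < Real.exp 2 := Real.exp_pos 2
  have hq : (89041 / 12209 : ℝ) = Real.exp 2 * (89041 / (12209 * Real.exp 2)) := by
    field_simp
  have hqpos : 0 < 89041 / (12209 * Real.exp 2) := by positivity
  have hqle : 89041 / (12209 * Real.exp 2) ≤ 0.9871 := by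
    rw [div_le_iff₀ (by positivity)]
    nlinarith
  have hlog : Real.log (89041 / 12209) ≤ 1.9871 := by
    rw [hq, Real.log_mul hpos.ne' hqpos.ne', Real.log_exp]
    have := Real.log_le_sub_one_of_pos hqpos
    linarith
  have hinv : Real.log (12209 / 89041) = -Real.log (89041 / 12209) := by
    rw [← Real.log_inv]; norm_num
  rw [hinv]
  linarith

/-- `log(15/14) ≤ 29/420` (trapezoid rule at `n = 14`). [folklore] -/
theorem log_fifteen_fourteenths_le : Real.log (15 / 14) ≤ 29 / 420 := by
  have h := log_one_add_inv_le_trapezoid (n := 14) (by norm_num)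
  norm_num at h
  linarith

/-- `log 24 ≥ 3.1780538` (`log 24 = 3 log 2 + log 3`, Mathlib decimals). [folklore] -/
theorem log_twentyfour_ge : 3.1780538 ≤ Real.log 24 := by
  have e : Real.log 24 = 3 * Real.log 2 + Real.log 3 := by
    rw [show (24 : ℝ) = 2 ^ 3 * 3 by norm_num, Real.log_mul (by norm_num) (by norm_num), Real.log_pow]
    push_cast; ring
  rw [e]
  have h2 := Real.log_two_gt_d9
  have h3 := Real.log_three_gt_d9
  linarith

/-- `log 23 ≥ 3.1354813` (`log 23 = log 24 − log(1 + 1/23)`, trapezoid). [folklore] -/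
theorem log_twentythree_ge : 3.1354813 ≤ Real.log 23 := by
  have h := log_one_add_inv_le_trapezoid (n := 23) (by norm_num)
  have e : Real.log (1 + (23 : ℝ)⁻¹) = Real.log 24 - Real.log 23 := by
    rw [show (1 : ℝ) + (23 : ℝ)⁻¹ = 24 / 23 by norm_num, Real.log_div (by norm_num) (by norm_num)]
  rw [e] at h
  have h24 := log_twentyfour_ge
  norm_num at h
  linarith

/-- `log 25 ≥ 3.2188701` (`log 25 = log 24 + log(1 + 1/24) ≥ log 24 + 2/49`). [folklore] -/
theorem log_twentyfive_ge : 3.2188701 ≤ Real.log 25 := by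
  have h := two_div_le_log_one_add_inv (a := 24) (by norm_num)
  have e : Real.log (1 + (24 : ℝ)⁻¹) = Real.log 25 - Real.log 24 := by
    rw [show (1 : ℝ) + (24 : ℝ)⁻¹ = 25 / 24 by norm_num, Real.log_div (by norm_num) (by norm_num)]
  rw [e] at h
  have h24 := log_twentyfour_ge
  norm_num at h
  linarith

/-- `log 27 ≥ 3.2958368` (`= 3 log 3`). [folklore] -/
theorem log_twentyseven_ge : 3.2958368 ≤ Real.log 27 := by
  rw [show (27 : ℝ) = 3 ^ 3 by norm_num, Real.log_pow]
  have h3 := Real.log_three_gt_d9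
  push_cast
  linarith

/-- `log (144/5) ≥ 3.35987` (`144/5 = 24·(1 + 1/5)`, `log(1 + 1/5) ≥ 2/11`). [folklore] -/
theorem log_ge_of_fourteen : 3.35987 ≤ Real.log (144 / 5) := by
  have h := two_div_le_log_one_add_inv (a := 5) (by norm_num)
  have e : Real.log (144 / 5) = Real.log 24 + Real.log (1 + (5 : ℝ)⁻¹) := by
    rw [show (144 / 5 : ℝ) = 24 * (1 + (5 : ℝ)⁻¹) by norm_num, Real.log_mul (by norm_num) (by norm_num)]
  rw [e]
  have h24 := log_twentyfour_ge
  norm_num at h ⊢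
  linarith

/-- The square-root loss of one node gap: `4(√(n+1) − 1/√(n+1) − √n + 1/√n) ≤ (2/√n)(1 + 1/n)`
(`√(n+1) − √n ≤ 1/(2√n)`, `1/√n − 1/√(n+1) ≤ 1/(2n√n)`), for real `n ≥ 1`. [folklore] -/
theorem sqrt_gap_loss_le {n : ℝ} (hn : 1 ≤ n) :
    4 * ((Real.sqrt (n + 1) - (Real.sqrt (n + 1))⁻¹) - (Real.sqrt n - (Real.sqrt n)⁻¹)) ≤
      2 / Real.sqrt n * (1 + 1 / n) := by
  have hn0 : 0 < n := by linarith
  set s := Real.sqrt n with hs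
  set s₁ := Real.sqrt (n + 1) with hs₁
  have hs0 : 0 < s := Real.sqrt_pos.2 hn0
  have hs1 : 1 ≤ s := by rw [hs]; exact Real.one_le_sqrt.2 hn
  have hss : s ^ 2 = n := Real.sq_sqrt hn0.le
  have hs₁s : s₁ ^ 2 = n + 1 := Real.sq_sqrt (by linarith)
  have hle : s ≤ s₁ := Real.sqrt_le_sqrt (by linarith)
  have hs₁0 : 0 < s₁ := lt_of_lt_of_le hs0 hle
  -- `s₁ - s = 1/(s₁ + s) ≤ 1/(2 s)`
  have hprod : (s₁ - s) * (s₁ + s) = 1 := by nlinarith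
  have hdiff : s₁ - s ≤ 1 / (2 * s) := by
    rw [le_div_iff₀ (by positivity)]
    nlinarith
  have hdiff0 : 0 ≤ s₁ - s := by linarith
  -- `1/s - 1/s₁ = (s₁ - s)/(s s₁) ≤ (1/(2s))/(s·s)`
  have hinv : s⁻¹ - s₁⁻¹ ≤ 1 / (2 * s ^ 3) := by
    have e : s⁻¹ - s₁⁻¹ = (s₁ - s) / (s * s₁) := by
      field_simp
    rw [e, div_le_div_iff₀ (by positivity) (by positivity)]
    have h1 : (s₁ - s) * (2 * s ^ 3) ≤ 1 / (2 * s) * (2 * s ^ 3) :=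
      mul_le_mul_of_nonneg_right hdiff (by positivity)
    have h2 : 1 / (2 * s) * (2 * s ^ 3) = s ^ 2 := by field_simp
    have h3 : s ^ 2 ≤ 1 * (s * s₁) := by nlinarith
    linarith
  have hn_eq : 1 / n = (s ^ 2)⁻¹ := by rw [hss, one_div]
  have key : 4 * ((s₁ - s₁⁻¹) - (s - s⁻¹)) = 4 * (s₁ - s) + 4 * (s⁻¹ - s₁⁻¹) := by ring
  rw [key, hn_eq]
  have e2 : 2 / s * (1 + (s ^ 2)⁻¹) = 4 * (1 / (2 * s)) + 4 * (1 / (2 * s ^ 3)) := by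
    field_simp; ring
  rw [e2]
  linarith

/-- **`Φ(n₀) ≥ −19/100` for every `n₀ ≥ 11`** — the constant inequality of the lever regime of `GapRung 1`, in exactly
the shape produced by `signedFarFieldMajorant` with `α = log n₀`, `ℓ = log (n₀ + 1) − log n₀`. [folklore] -/
theorem gapPhi_ge (n : ℕ) (hn : 11 ≤ n) :
    -(19 / 100 : ℝ) ≤ Real.log (12209 / 89041)
      - (Real.log (Real.exp (Real.log (n + 1) - Real.log n) - 1) - Real.log (Real.exp (Real.log (n + 1) - Real.log n) + 1))
      - 97 / 28 * (4 * Real.log (15 / 14) - (Real.log (n + 1) - Real.log n))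
      - 8 * (Real.sinh ((Real.log n + (Real.log (n + 1) - Real.log n)) / 2) - Real.sinh (Real.log n / 2)) := by
  have hnR : (11 : ℝ) ≤ n := by exact_mod_cast hn
  have hn0 : (0 : ℝ) < n := by linarith
  have hn1 : (0 : ℝ) < n + 1 := by linarith
  -- `e^ℓ = (n+1)/n`
  have hexp : Real.exp (Real.log (n + 1) - Real.log n) = (n + 1) / n := by
    rw [Real.exp_sub, Real.exp_log hn1, Real.exp_log hn0]
  -- the tanh-log term is `-log(2n+1)`
  have hlogterm : Real.log (Real.exp (Real.log (n + 1) - Real.log n) - 1) -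
      Real.log (Real.exp (Real.log (n + 1) - Real.log n) + 1) = -Real.log (2 * n + 1) := by
    rw [hexp]
    have e1 : ((n : ℝ) + 1) / n - 1 = 1 / n := by field_simp; ring
    have e2 : ((n : ℝ) + 1) / n + 1 = (2 * n + 1) / n := by field_simp; ring
    rw [e1, e2, Real.log_div (by norm_num) hn0.ne', Real.log_div (by positivity) hn0.ne', Real.log_one]
    ring
  -- the sinh terms are `(√m − 1/√m)/2`
  have hsinh : ∀ m : ℝ, 0 < m → Real.sinh (Real.log m / 2) = (Real.sqrt m - (Real.sqrt m)⁻¹) / 2 := by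
    intro m hm
    rw [Real.sinh_eq, Real.exp_neg]
    have e : Real.exp (Real.log m / 2) = Real.sqrt m := by
      rw [Real.sqrt_eq_rpow, Real.rpow_def_of_pos hm]
      congr 1; ring
    rw [e]
  have hαℓ : (Real.log n + (Real.log (n + 1) - Real.log n)) / 2 = Real.log (n + 1) / 2 := by ring
  rw [hlogterm, hαℓ, hsinh _ hn1, hsinh _ hn0]
  have hloss := sqrt_gap_loss_le (n := (n : ℝ)) (by linarith)
  have hsq : 8 * ((Real.sqrt (n + 1) - (Real.sqrt (n + 1))⁻¹) / 2 - (Real.sqrt n - (Real.sqrt n)⁻¹) / 2) =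
      4 * ((Real.sqrt (n + 1) - (Real.sqrt (n + 1))⁻¹) - (Real.sqrt n - (Real.sqrt n)⁻¹)) := by ring
  rw [hsq]
  -- constants
  have hC := log_tanh_t₁_ge
  have h1514 := log_fifteen_fourteenths_le
  -- `ℓ ≥ 2/(2n+1)`
  have hℓ : 2 / (2 * n + 1) ≤ Real.log (n + 1) - Real.log n := by
    have h := two_div_le_log_one_add_inv (a := (n : ℝ)) hn0
    rwa [show (1 : ℝ) + (n : ℝ)⁻¹ = (n + 1) / n by field_simp, Real.log_div hn1.ne' hn0.ne'] at h
  -- `√n` facts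
  set s := Real.sqrt (n : ℝ) with hs
  have hs0 : 0 < s := Real.sqrt_pos.2 hn0
  have hss : s ^ 2 = n := Real.sq_sqrt hn0.le
  -- the generic reduction: it suffices to bound `log(2n+1)` below and `2/s (1 + 1/n)` above
  -- case analysis on `n`
  rcases Nat.lt_or_ge n 14 with hlt | hge
  · interval_cases n
    · -- n = 11
      push_cast at hℓ hloss hs ⊢
      have e : (2 * (11 : ℝ) + 1) = 23 := by norm_num
      rw [e] at hℓ ⊢
      have hL : 3.1354813 ≤ Real.log 23 := log_twentythree_ge
      have hS : 3.3166 ≤ s := by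
        rw [hs]; exact Real.le_sqrt_of_sq_le (by norm_num)
      have hinvs : 2 / s * (1 + 1 / (11 : ℝ)) ≤ 2 / 3.3166 * (1 + 1 / 11) := by
        gcongr
      nlinarith [hL, hℓ, hloss, hinvs, hC, h1514]
    · -- n = 12
      push_cast at hℓ hloss hs ⊢
      have e : (2 * (12 : ℝ) + 1) = 25 := by norm_num
      rw [e] at hℓ ⊢
      have hL : 3.2188701 ≤ Real.log 25 := log_twentyfive_ge
      have hS : 3.4641 ≤ s := by
        rw [hs]; exact Real.le_sqrt_of_sq_le (by norm_num)
      have hinvs : 2 / s * (1 + 1 / (12 : ℝ)) ≤ 2 / 3.4641 * (1 + 1 / 12) := by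
        gcongr
      nlinarith [hL, hℓ, hloss, hinvs, hC, h1514]
    · -- n = 13
      push_cast at hℓ hloss hs ⊢
      have e : (2 * (13 : ℝ) + 1) = 27 := by norm_num
      rw [e] at hℓ ⊢
      have hL : 3.2958368 ≤ Real.log 27 := log_twentyseven_ge
      have hS : 3.6055 ≤ s := by
        rw [hs]; exact Real.le_sqrt_of_sq_le (by norm_num)
      have hinvs : 2 / s * (1 + 1 / (13 : ℝ)) ≤ 2 / 3.6055 * (1 + 1 / 13) := by
        gcongr
      nlinarith [hL, hℓ, hloss, hinvs, hC, h1514]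
  · -- n ≥ 14
    have hnR14 : (14 : ℝ) ≤ n := by exact_mod_cast hge
    have hL : 3.35987 ≤ Real.log (2 * n + 1) :=
      le_trans log_ge_of_fourteen (Real.log_le_log (by norm_num) (by linarith))
    have hS : 3.7416 ≤ s := by
      rw [hs]
      exact Real.le_sqrt_of_sq_le (by nlinarith)
    have hinvs : 2 / s * (1 + 1 / (n : ℝ)) ≤ 2 / 3.7416 * (1 + 1 / 14) := by
      gcongr
    have hℓ0 : 0 ≤ Real.log (n + 1) - Real.log n := le_trans (by positivity) hℓ
    nlinarith [hL, hℓ0, hloss, hinvs, hC, h1514]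

end Summit.RiemannHypothesis.RiemannHypothesis.Theorems.SignCone

end
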